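import Summits.ResolutionOfSingularities.ResolutionOfSingularities.Theorems.MarkedTransferCampaignW46HostSurfaces
import Summits.ResolutionOfSingularities.ResolutionOfSingularities.Theorems.MarkedTransferCampaignW46ThreefoldsGammaFreeGlobalLadderWitness
import Summits.ResolutionOfSingularities.ResolutionOfSingularities.Theorems.MarkedTransferCampaignW46ThreefoldsOrderOneSlice
import Literature.AlgebraicGeometry.Hironaka2017.Proofs.S16Proof.NablaNCObstructionPlane
import HarnessLib

/-!
# [OURS · L1 W4.6 rung (i), host words] A KERNEL WITNESS WITH A BOUNDARY THAT MATTERS — the line `(yᵃ, m)` on `𝔸²` against the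
# TANGENT parabola boundary `[V(y − x²)]`: an input of `HypersurfaceOrderReductionDimLE p 2` whose obvious centre is NOT admissible

Cell res-hironaka, LADDER-RESOLUTION rung L (D-0089), slot W4.6, rung (i) SURFACES in the host item's own words; seat res-L1-s46-pv-1 (gen 6).
`--kind proof --supports` stmt-ResolutionOfSingularities-16156 `--as helper`. NON-VACUITY of the boundary binder of the surface rung
`CampaignW46.hypersurfaceOrderReductionDimLE_two` (`…HostSurfaces.lean`): the rung quantifies over ALL snc boundaries `E`, and the boundary
changes the answer. Everything is OURS, evaluated at EXPLICIT tree objects (the plane specimen `Thm717PlaneSpecimen.Z K = Spec K[x,y]`, its line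
`V(y)` = `(E K).J`, and the parabola `H = V(y − x²)` of `NablaNCObstructionPlane.lean`, whose order / snc / non-admissibility facts are CITED);
nothing is a statement of H. Hironaka's manuscript [Hironaka2017] (the cited `Proofs/S16Proof` modules are kernel bookkeeping on explicit
specimens). AI-written; AI review is weaker than expert review.

## What is proved (no definitions; `K : Type` perfect of characteristic `p`, the universe of the host item)

* `hasSNC_line` — `[𝓘_{V(y)}]` is an snc boundary on the plane (order `≤ 1` everywhere, res-L1-s46-pv-3's `hasSNC_singleton_of_idealOrder_le_one`).
* **`exists_isMarkedResolution_linePow_parabola`** — for every `a ≥ 1`, `m ≥ 1`: the marked ideal `(𝔸²_K, 𝓘_{V(y)}ᵃ, [𝓘_{V(y−x²)}], m)`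
  HAS A BGMW MARKED RESOLUTION — an instance of the surface rung with a NON-EMPTY boundary TANGENT to the support (`V(y) ∩ V(y − x²)`
  is the double point `Spec K[x]/(x²)`).
* `not_hasSNCWith_parabola_linePow_support` — … and the boundary MATTERS: the support `V(y)` itself (the centre that resolves
  `(𝓘_{V(y)}ᵃ, ∅, m)` by identity blow-ups, `a ≥ m`) is NOT an admissible centre for the boundary `[V(y − x²)]` (tree
  `not_hasSNCWith_parabola_line`), so every marked resolution provided by the rung must first separate line and parabola by point blow-ups.
* `exists_isMarkedResolution_cusp_anyBoundary` — the plane cusps `(y^p + xⁿ)·𝒪` of the Γ-free ladder witness (res-D-pv-036's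
  `…LadderWitness.lean`) with ANY snc boundary on `𝔸²_K` are settled by the rung (plug lemma, host words).

## Sources

* E. Bierstone, D. Grigoriev, P. Milman, J. Włodarczyk, arXiv:1206.3090, Def. 3.1.1–3.1.3. [BierstoneGrigorievMilmanWlodarczyk2011]
* H. Hironaka, ms. 2017-03-23 — scope only, under adjudication, not cited as fact. [Hironaka2017]
-/

noncomputable section

set_option linter.dupNamespace false -- mandated namespace of this single-conjunct summit

open CategoryTheory AlgebraicGeometry TopologicalSpace IsLocalRing MvPolynomial

namespace Summit.ResolutionOfSingularities.ResolutionOfSingularities.Theorems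

namespace CampaignW46

open Literature.AlgebraicGeometry.Resolution
open Literature.AlgebraicGeometry.Hironaka2017 Literature.AlgebraicGeometry.Hironaka2017.SpecOrders
open Literature.AlgebraicGeometry.Hironaka2017.S07Permissible.Thm717PlaneSpecimen
open Literature.AlgebraicGeometry.Hironaka2017.S16Proof
open LadderWitness

section Plane

variable (K : Type) [Field K]

/-- The structure morphism of the plane specimen is the affine-space morphism `𝔸²_K → Spec K`. [folklore] -/
theorem hom_eq : hom K = Spec.map (CommRingCat.ofHom (algebraMap K (MvPolynomial (Fin 2) K))) := rfl

/-- **`[𝓘_{V(y)}]` is an snc boundary on the plane** (`ord ≤ 1` everywhere, tree `idealOrder_y_le_one`). [cite: Kollar2007, Def. 3.24] -/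
theorem hasSNC_line : HasSNC [(E K).J] :=
  hasSNC_singleton_of_idealOrder_le_one (isRegular_plane K) (isEffectiveCartier_planeE_J K) (idealOrder_y_le_one K)

/-- `𝓘_{V(y)} ≠ ⊥`. [folklore] -/
theorem lineIdeal_ne_bot : (E K).J ≠ ⊥ :=
  HasSNC.ne_bot_of_mem (hasSNC_line K) (List.mem_singleton_self _)

/-- `𝓘_{V(y)}ᵃ ≠ ⊥` and effective Cartier. [folklore] -/
theorem linePow_ne_bot_and_isEffectiveCartier (a : ℕ) : (E K).J ^ a ≠ ⊥ ∧ IsEffectiveCartier ((E K).J ^ a) := by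
  refine ⟨fun h => ?_, (isEffectiveCartier_planeE_J K).pow a⟩
  have hle : (E K).J ^ a ≤ ⊥ := h.le
  induction a with
  | zero =>
    rw [pow_zero, Scheme.IdealSheafData.one_eq_top, top_le_iff] at hle
    exact lineIdeal_ne_bot K (by rw [← le_bot_iff, hle]; exact le_top)
  | succ n ih =>
    -- `J^{n+1} = ⊥` forces `J = ⊥` or `J^n = ⊥`: use the Cartier factor `J`
    have h0 : (E K).J ^ (n + 1) = ⊥ := le_bot_iff.mp hle
    rw [pow_succ] at h0
    exact lineIdeal_ne_bot K ((((isEffectiveCartier_planeE_J K).pow n).eq_bot_of_mul_eq_bot h0))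

/-- **[OURS · W4.6 rung (i), host words — witness] THE LINE AGAINST THE TANGENT PARABOLA HAS A MARKED RESOLUTION.** For `K` perfect of
characteristic `p`, `a ≥ 0` with `𝓘_{V(y)}ᵃ ≠ ⊥` automatic, and every `m ≥ 1`, the marked ideal `(𝔸²_K, 𝓘_{V(y)}ᵃ, [𝓘_{V(y − x²)}], m)` has a BGMW
marked resolution — the surface rung `hypersurfaceOrderReductionDimLE_two p` read on the plane specimen with the parabola boundary (snc:
tree `hasSNC_parabola`). [cite: BierstoneGrigorievMilmanWlodarczyk2011, Def. 3.1.3] -/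
theorem exists_isMarkedResolution_linePow_parabola (p : ℕ) [Fact p.Prime] [CharP K p] [PerfectField K] (a : ℕ) {m : ℕ}
    (hm : 1 ≤ m) :
    ∃ (X' : Scheme.{0}) (Φ : X' ⟶ Z K) (M' : MarkedIdeal X'),
      IsMarkedResolution (⟨(E K).J ^ a, [shf (R K) (Ideal.span {(X 1 - X 0 ^ 2 : R K)})], m⟩ : MarkedIdeal (Z K)) Φ M' :=
  hypersurfaceOrderReductionDimLE_two p Fact.out K (Z K) (hom K) (by rw [hom_eq]; exact isSeparated_affineSpace K 2)
    (by rw [hom_eq]; exact locallyOfFiniteType_affineSpace K 2) (by rw [hom_eq]; exact quasiCompact_affineSpace K 2)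
    (isIntegral_affineSpace K 2) (isRegular_plane K) (topologicalKrullDim_affineSpace_le K 2 le_rfl) _
    (linePow_ne_bot_and_isEffectiveCartier K a).1 (linePow_ne_bot_and_isEffectiveCartier K a).2 _ (hasSNC_parabola K) m hm

/-- **… AND THE BOUNDARY MATTERS: the support `V(y)` is not an admissible centre for the parabola boundary** — for `a ≥ 1` the support of
`𝓘_{V(y)}ᵃ` is the line `C = V(y)`, and `¬ HasSNCWith [𝓘_{V(y − x²)}] 𝓘(C)` (tree `not_hasSNCWith_parabola_line`: the stratum
`V(y) ∩ V(y − x²) = Spec K[x]/(x²)` is not regular). So the blow-up along the support, which is an iso and settles `(𝓘_{V(y)}ᵃ, ∅, m)`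
(`a ≥ m`) in one BGMW step, is forbidden here: any marked resolution must first blow up the tangency point.
[cite: BierstoneGrigorievMilmanWlodarczyk2011, Def. 3.1.3 (2)] -/
theorem not_hasSNCWith_parabola_linePow_support (p : ℕ) [Fact p.Prime] [CharP K p] {a : ℕ} (ha : 1 ≤ a) :
    (((E K).J ^ a).support : Set (Z K)) = (C K : Set (Z K)) ∧
      ¬ HasSNCWith [shf (R K) (Ideal.span {(X 1 - X 0 ^ 2 : R K)})] (Scheme.IdealSheafData.vanishingIdeal (C K)) := by
  refine ⟨?_, not_hasSNCWith_parabola_line K p⟩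
  rw [Scheme.IdealSheafData.support_pow _ a (by omega)]
  rfl

end Plane

/-- **The plane cusps with ANY snc boundary** (plug lemma, host words): for `K : Type` perfect of characteristic `p`, `1 ≤ n`, every snc
boundary `E` on `𝔸²_K = U82Gap.Z K` and every `m ≥ 1`, the marked ideal `((y^p + xⁿ)·𝒪, E, m)` has a BGMW marked resolution (the Γ-free
ladder witness of res-D-pv-036, `orderReducible_cusp_of_dimLE_two`, upgraded to the host words). [cite: BierstoneGrigorievMilmanWlodarczyk2011, Def. 3.1.3] -/
theorem exists_isMarkedResolution_cusp_anyBoundary (p : ℕ) [Fact p.Prime] (K : Type) [Field K] [CharP K p] [PerfectField K]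
    {n : ℕ} (h1n : 1 ≤ n) (E : List (U82Gap.Z K).IdealSheafData) (hE : HasSNC E) {m : ℕ} (hm : 1 ≤ m) :
    ∃ (X' : Scheme.{0}) (Φ : X' ⟶ U82Gap.Z K) (M' : MarkedIdeal X'),
      IsMarkedResolution (⟨shf (U82Gap.A K) (Ideal.span {X 1 ^ p + X 0 ^ n}), E, m⟩ : MarkedIdeal (U82Gap.Z K)) Φ M' :=
  hypersurfaceOrderReductionDimLE_two p Fact.out K (U82Gap.Z K) (U82Gap.f K) (isSeparated_f K) (locallyOfFiniteType_f K)
    (quasiCompact_f K) (isIntegral_Z K) (U82Gap.isRegular_Z K) (topologicalKrullDim_Z_le_two K) _ (shf_cusp_ne_bot p K h1n)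
    (isEffectiveCartier_shf_cusp p K h1n) E hE m hm

end CampaignW46

end Summit.ResolutionOfSingularities.ResolutionOfSingularities.Theorems

end
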